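import Summits.AnomalousDissipation.AnomalousDissipation.Theorems.MomentParityPathExt

/-!
# Route MomentParity · `GalerkinEnsembleRealization` — the energy and dissipation functionals on
  the trajectory space

Continuity / measurability / bounds of the observables `pathEnergy`, `pathEnergyTot`,
`pathDiss` and of their unit-time means `energyMeanTrunc`, `energyMean`, `dissMean`
(`MomentParityDefs`) on the trajectory space `pathSpace R L`, and the **Birkhoff-sum identities**
`∑_{i<n} F(θ^i ω) = ∫₀ⁿ g(ω̄(t)) dt` turning Birkhoff averages along the shift into continuous-time
averages (stmt-AnomalousDissipation-11466).
-/

noncomputable section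

set_option linter.dupNamespace false

open MeasureTheory Set Filter Topology Function Metric
open scoped BigOperators

namespace Summit.AnomalousDissipation.AnomalousDissipation.Theorems.MomentParity

open Literature.Analysis.FunctionSpaces Literature.Analysis.FunctionSpaces.Torus Literature.Analysis.FluidPDE

variable {d : Type*} [Fintype d] {R : ℝ} {L : (d → ℤ) → ℝ}

/-! ### Continuity of the truncated energy and of the resolved dissipation -/

/-- The truncated energy is jointly continuous on `𝒦 × ℝ`. -/
theorem continuous_pathEnergy (R : ℝ) (L : (d → ℤ) → ℝ) (T : Finset (d → ℤ)) :
    Continuous fun p : ↥(pathSpace (d := d) R L) × ℝ => pathEnergy T p.1.1 p.2 := by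
  unfold pathEnergy
  exact continuous_finsetSum _ fun k _ => ((continuous_pathExt_subtype_prod R L k).norm).pow 2

variable [DecidableEq d] in
/-- The resolved dissipation is jointly continuous on `𝒦 × ℝ`. -/
theorem continuous_pathDiss (R : ℝ) (L : (d → ℤ) → ℝ) (ν : ℝ) (K : ℕ) :
    Continuous fun p : ↥(pathSpace (d := d) R L) × ℝ => pathDiss ν K p.1.1 p.2 := by
  unfold pathDiss
  refine continuous_const.mul (continuous_const.mul (continuous_finsetSum _ fun k _ => ?_))
  exact continuous_const.mul (((continuous_pathExt_subtype_prod R L k).norm).pow 2)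

/-- The truncated energies are monotone in the set of frequencies. -/
theorem pathEnergy_mono {T T' : Finset (d → ℤ)} (h : T ⊆ T') (ω : Path d) (t : ℝ) :
    pathEnergy T ω t ≤ pathEnergy T' ω t :=
  Finset.sum_le_sum_of_subset_of_nonneg h fun _ _ _ => sq_nonneg _

/-- The truncated energy is nonnegative. -/
theorem pathEnergy_nonneg (T : Finset (d → ℤ)) (ω : Path d) (t : ℝ) : 0 ≤ pathEnergy T ω t :=
  Finset.sum_nonneg fun _ _ => sq_nonneg _

/-- The truncated energy is at most `R²` on `𝒦`. -/
theorem pathEnergy_le {ω : Path d} (hω : ω ∈ pathSpace R L) (T : Finset (d → ℤ)) (t : ℝ) :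
    pathEnergy T ω t ≤ R ^ 2 := sum_norm_pathExt_sq_le hω t T

/-- The truncated energy is at most the total energy on `𝒦`. -/
theorem pathEnergy_le_pathEnergyTot {ω : Path d} (hω : ω ∈ pathSpace R L) (T : Finset (d → ℤ))
    (t : ℝ) : pathEnergy T ω t ≤ pathEnergyTot ω t :=
  (summable_norm_pathExt_sq hω t).sum_le_tsum T fun _ _ => sq_nonneg _

variable [DecidableEq d]

/-- **The truncated energies over the frequency balls exhaust the total energy.** -/
theorem tendsto_pathEnergy_freqBall {ω : Path d} (hω : ω ∈ pathSpace R L) (t : ℝ) :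
    Tendsto (fun n => pathEnergy (freqBall n) ω t) atTop (𝓝 (pathEnergyTot ω t)) :=
  ((summable_norm_pathExt_sq hω t).hasSum.comp tendsto_freqBall_atTop)

/-- The resolved dissipation is nonnegative for `ν ≥ 0`. -/
theorem pathDiss_nonneg {ν : ℝ} (hν : 0 ≤ ν) (K : ℕ) (ω : Path d) (t : ℝ) : 0 ≤ pathDiss ν K ω t := by
  unfold pathDiss
  refine mul_nonneg hν (mul_nonneg (by positivity) (Finset.sum_nonneg fun k _ => ?_))
  exact mul_nonneg (freqNormSq_nonneg k) (sq_nonneg _)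

/-- The resolved dissipation is at most `ν 4π² K² R²` on `𝒦` (for `ν ≥ 0`). -/
theorem pathDiss_le {ν : ℝ} (hν : 0 ≤ ν) (K : ℕ) {ω : Path d} (hω : ω ∈ pathSpace R L) (t : ℝ) :
    pathDiss ν K ω t ≤ ν * (4 * Real.pi ^ 2 * ((K : ℝ) ^ 2 * R ^ 2)) := by
  unfold pathDiss
  refine mul_le_mul_of_nonneg_left (mul_le_mul_of_nonneg_left ?_ (by positivity)) hν
  calc ∑ k ∈ freqBall K, freqNormSq k * ‖pathExt ω t k‖ ^ 2
      ≤ ∑ k ∈ freqBall K, (K : ℝ) ^ 2 * ‖pathExt ω t k‖ ^ 2 :=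
        Finset.sum_le_sum fun k hk => mul_le_mul_of_nonneg_right (mem_freqBall.1 hk) (sq_nonneg _)
    _ = (K : ℝ) ^ 2 * ∑ k ∈ freqBall K, ‖pathExt ω t k‖ ^ 2 := by rw [Finset.mul_sum]
    _ ≤ (K : ℝ) ^ 2 * R ^ 2 := mul_le_mul_of_nonneg_left (sum_norm_pathExt_sq_le hω t _) (sq_nonneg _)

/-! ### Measurability of the total energy -/

/-- The total energy is measurable on `𝒦 × ℝ` (a pointwise limit of continuous functions). -/
theorem measurable_pathEnergyTot (R : ℝ) (L : (d → ℤ) → ℝ) :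
    Measurable fun p : ↥(pathSpace (d := d) R L) × ℝ => pathEnergyTot p.1.1 p.2 :=
  measurable_of_tendsto_metrizable (fun n => (continuous_pathEnergy R L (freqBall n)).measurable)
    (tendsto_pi_nhds.2 fun p => tendsto_pathEnergy_freqBall p.1.2 p.2)

/-- For a fixed path of `𝒦`, the total energy is measurable in time. -/
theorem measurable_pathEnergyTot_time {ω : Path d} (hω : ω ∈ pathSpace R L) :
    Measurable fun t => pathEnergyTot ω t :=
  measurable_of_tendsto_metrizable
    (fun n => ((continuous_pathEnergy R L (freqBall n)).comp
      (Continuous.prodMk_right (⟨ω, hω⟩ : ↥(pathSpace R L)))).measurable)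
    (tendsto_pi_nhds.2 fun t => tendsto_pathEnergy_freqBall hω t)

/-! ### The unit-time means -/

omit [DecidableEq d] in
/-- The mean truncated energy is continuous on `𝒦`. -/
theorem continuous_energyMeanTrunc (R : ℝ) (L : (d → ℤ) → ℝ) (T : Finset (d → ℤ)) :
    Continuous fun ω : ↥(pathSpace (d := d) R L) => energyMeanTrunc T ω.1 :=
  intervalIntegral.continuous_parametric_intervalIntegral_of_continuous'
    (continuous_pathEnergy R L T) 0 1

/-- The mean resolved dissipation is continuous on `𝒦`. -/
theorem continuous_dissMean (R : ℝ) (L : (d → ℤ) → ℝ) (ν : ℝ) (K : ℕ) :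
    Continuous fun ω : ↥(pathSpace (d := d) R L) => dissMean ν K ω.1 :=
  intervalIntegral.continuous_parametric_intervalIntegral_of_continuous'
    (continuous_pathDiss R L ν K) 0 1

/-- The total energy of a path of `𝒦` is interval integrable on every interval. -/
theorem intervalIntegrable_pathEnergyTot {ω : Path d} (hω : ω ∈ pathSpace R L) (a b : ℝ) :
    IntervalIntegrable (fun t => pathEnergyTot ω t) volume a b := by
  refine (intervalIntegrable_const (c := R ^ 2)).mono_fun
    (measurable_pathEnergyTot_time hω).aestronglyMeasurable (ae_of_all _ fun t => ?_)
  simp only [Real.norm_eq_abs, abs_of_nonneg (pathEnergyTot_nonneg ω t)]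
  exact (pathEnergyTot_le hω t).trans (le_abs_self _)

omit [DecidableEq d] in
/-- The truncated energy of a path of `𝒦` is interval integrable on every interval. -/
theorem intervalIntegrable_pathEnergy {ω : Path d} (hω : ω ∈ pathSpace R L) (T : Finset (d → ℤ))
    (a b : ℝ) : IntervalIntegrable (fun t => pathEnergy T ω t) volume a b :=
  ((continuous_pathEnergy R L T).comp (Continuous.prodMk_right (⟨ω, hω⟩ : ↥(pathSpace R L)))
    ).intervalIntegrable a b

/-- The resolved dissipation of a path of `𝒦` is interval integrable on every interval. -/
theorem intervalIntegrable_pathDiss {ω : Path d} (hω : ω ∈ pathSpace R L) (ν : ℝ) (K : ℕ)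
    (a b : ℝ) : IntervalIntegrable (fun t => pathDiss ν K ω t) volume a b :=
  ((continuous_pathDiss R L ν K).comp (Continuous.prodMk_right (⟨ω, hω⟩ : ↥(pathSpace R L)))
    ).intervalIntegrable a b

/-- **Monotone convergence of the means**: `energyMeanTrunc (freqBall n) ω → energyMean ω`. -/
theorem tendsto_energyMeanTrunc {ω : Path d} (hω : ω ∈ pathSpace R L) :
    Tendsto (fun n => energyMeanTrunc (freqBall n) ω) atTop (𝓝 (energyMean ω)) := by
  unfold energyMeanTrunc energyMean
  refine intervalIntegral.tendsto_integral_filter_of_dominated_convergence (fun _ => R ^ 2)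
    (Eventually.of_forall fun n => ?_) (Eventually.of_forall fun n => ae_of_all _ fun t _ => ?_)
    intervalIntegrable_const (ae_of_all _ fun t _ => tendsto_pathEnergy_freqBall hω t)
  · exact ((continuous_pathEnergy R L (freqBall n)).comp
      (Continuous.prodMk_right (⟨ω, hω⟩ : ↥(pathSpace R L)))).aestronglyMeasurable
  · rw [Real.norm_eq_abs, abs_of_nonneg (pathEnergy_nonneg _ ω t)]
    exact pathEnergy_le hω _ t

/-- The mean total energy is measurable on `𝒦`. -/
theorem measurable_energyMean (R : ℝ) (L : (d → ℤ) → ℝ) :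
    Measurable fun ω : ↥(pathSpace (d := d) R L) => energyMean ω.1 :=
  measurable_of_tendsto_metrizable (fun n => (continuous_energyMeanTrunc R L (freqBall n)).measurable)
    (tendsto_pi_nhds.2 fun ω => tendsto_energyMeanTrunc ω.2)

omit [DecidableEq d] in
/-- Bounds for the mean truncated energy on `𝒦`: `0 ≤ F ≤ R²`. -/
theorem energyMeanTrunc_mem_Icc {ω : Path d} (hω : ω ∈ pathSpace R L) (T : Finset (d → ℤ)) :
    energyMeanTrunc T ω ∈ Icc 0 (R ^ 2) := by
  unfold energyMeanTrunc
  constructor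
  · exact intervalIntegral.integral_nonneg zero_le_one fun t _ => pathEnergy_nonneg T ω t
  · have h := intervalIntegral.integral_mono_on zero_le_one (intervalIntegrable_pathEnergy hω T 0 1)
      intervalIntegrable_const fun t _ => pathEnergy_le hω T t
    simpa using h

/-- Bounds for the mean total energy on `𝒦`: `0 ≤ F_e ≤ R²`. -/
theorem energyMean_mem_Icc {ω : Path d} (hω : ω ∈ pathSpace R L) : energyMean ω ∈ Icc 0 (R ^ 2) := by
  unfold energyMean
  constructor
  · exact intervalIntegral.integral_nonneg zero_le_one fun t _ => pathEnergyTot_nonneg ω t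
  · have h := intervalIntegral.integral_mono_on zero_le_one (intervalIntegrable_pathEnergyTot hω 0 1)
      intervalIntegrable_const fun t _ => pathEnergyTot_le hω t
    simpa using h

/-- The mean truncated energy is at most the mean total energy on `𝒦`. -/
theorem energyMeanTrunc_le_energyMean {ω : Path d} (hω : ω ∈ pathSpace R L) (T : Finset (d → ℤ)) :
    energyMeanTrunc T ω ≤ energyMean ω :=
  intervalIntegral.integral_mono_on zero_le_one (intervalIntegrable_pathEnergy hω T 0 1)
    (intervalIntegrable_pathEnergyTot hω 0 1) fun t _ => pathEnergy_le_pathEnergyTot hω T t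

/-- Bounds for the mean resolved dissipation on `𝒦` (`ν ≥ 0`): `0 ≤ F_d ≤ ν4π²K²R²`. -/
theorem dissMean_mem_Icc {ν : ℝ} (hν : 0 ≤ ν) (K : ℕ) {ω : Path d} (hω : ω ∈ pathSpace R L) :
    dissMean ν K ω ∈ Icc 0 (ν * (4 * Real.pi ^ 2 * ((K : ℝ) ^ 2 * R ^ 2))) := by
  unfold dissMean
  constructor
  · exact intervalIntegral.integral_nonneg zero_le_one fun t _ => pathDiss_nonneg hν K ω t
  · have h := intervalIntegral.integral_mono_on zero_le_one (intervalIntegrable_pathDiss hω ν K 0 1)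
      intervalIntegrable_const fun t _ => pathDiss_le hν K hω t
    simpa using h

/-! ### Birkhoff sums along the shift are continuous-time integrals -/

omit [DecidableEq d] in
/-- Iterates of the restricted shift are iterates of the shift. -/
theorem coe_iterate_pathShiftOn (R : ℝ) (L : (d → ℤ) → ℝ) (ω : ↥(pathSpace (d := d) R L)) (i : ℕ) :
    ((pathShiftOn R L (pathShift_mapsTo R L))^[i] ω : Path d) = pathShift^[i] ω.1 := by
  induction i with
  | zero => rfl
  | succ i ih => rw [iterate_succ_apply', iterate_succ_apply', coe_pathShiftOn_apply, ih]

/-- **Birkhoff sums of a unit-time mean are integrals over `[0, n]`**: for `g : ℝ → ℝ` locally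
integrable with `G ω' = ∫₀¹ g(ω̄'(t)) dt` "read through the extension", if `G (θ^i ω) = ∫ᵢ^{i+1} g`
then `∑_{i<n} G(θ^i ω) = ∫₀ⁿ g`. Abstract bookkeeping used for the three observables. -/
theorem sum_range_eq_intervalIntegral {g : ℝ → ℝ} {G : ℕ → ℝ}
    (hG : ∀ i : ℕ, G i = ∫ t in (i : ℝ)..(i + 1 : ℕ), g t)
    (hint : ∀ a b : ℝ, IntervalIntegrable g volume a b) (n : ℕ) :
    ∑ i ∈ Finset.range n, G i = ∫ t in (0 : ℝ)..n, g t := by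
  have h := intervalIntegral.sum_integral_adjacent_intervals (a := fun i : ℕ => (i : ℝ)) (μ := volume)
    (f := g) (n := n) fun k _ => hint _ _
  simp only [Nat.cast_zero] at h
  rw [← h]
  exact Finset.sum_congr rfl fun i _ => hG i

omit [DecidableEq d] in
/-- The mean total energy along the shift: `F_e(θ^i ω) = ∫ᵢ^{i+1} e(ω̄(t)) dt`. -/
theorem energyMean_iterate_pathShift {ω : Path d} (hω : ω ∈ pathSpace R L) (i : ℕ) :
    energyMean (pathShift^[i] ω) = ∫ t in (i : ℝ)..(i + 1 : ℕ), pathEnergyTot ω t := by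
  unfold energyMean
  have heq : ∀ t ∈ uIcc (0 : ℝ) 1, pathEnergyTot (pathShift^[i] ω) t = pathEnergyTot ω (t + i) := by
    intro t ht
    rw [uIcc_of_le zero_le_one] at ht
    unfold pathEnergyTot
    simp_rw [pathExt_iterate_pathShift hω i ht.1]
  rw [intervalIntegral.integral_congr heq, intervalIntegral.integral_comp_add_right (fun t => pathEnergyTot ω t)]
  push_cast
  rw [zero_add, add_comm]

omit [DecidableEq d] in
/-- The mean truncated energy along the shift. -/
theorem energyMeanTrunc_iterate_pathShift {ω : Path d} (hω : ω ∈ pathSpace R L) (T : Finset (d → ℤ))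
    (i : ℕ) : energyMeanTrunc T (pathShift^[i] ω) = ∫ t in (i : ℝ)..(i + 1 : ℕ), pathEnergy T ω t := by
  unfold energyMeanTrunc
  have heq : ∀ t ∈ uIcc (0 : ℝ) 1, pathEnergy T (pathShift^[i] ω) t = pathEnergy T ω (t + i) := by
    intro t ht
    rw [uIcc_of_le zero_le_one] at ht
    unfold pathEnergy
    simp_rw [pathExt_iterate_pathShift hω i ht.1]
  rw [intervalIntegral.integral_congr heq, intervalIntegral.integral_comp_add_right (fun t => pathEnergy T ω t)]
  push_cast
  rw [zero_add, add_comm]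

/-- The mean resolved dissipation along the shift. -/
theorem dissMean_iterate_pathShift {ω : Path d} (hω : ω ∈ pathSpace R L) (ν : ℝ) (K : ℕ) (i : ℕ) :
    dissMean ν K (pathShift^[i] ω) = ∫ t in (i : ℝ)..(i + 1 : ℕ), pathDiss ν K ω t := by
  unfold dissMean
  have heq : ∀ t ∈ uIcc (0 : ℝ) 1, pathDiss ν K (pathShift^[i] ω) t = pathDiss ν K ω (t + i) := by
    intro t ht
    rw [uIcc_of_le zero_le_one] at ht
    unfold pathDiss
    simp_rw [pathExt_iterate_pathShift hω i ht.1]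
  rw [intervalIntegral.integral_congr heq, intervalIntegral.integral_comp_add_right (fun t => pathDiss ν K ω t)]
  push_cast
  rw [zero_add, add_comm]

/-- **Birkhoff sums of the mean total energy**: `∑_{i<n} F_e(θ^i ω) = ∫₀ⁿ e(ω̄(t)) dt`. -/
theorem birkhoffSum_energyMean (ω : ↥(pathSpace (d := d) R L)) (n : ℕ) :
    birkhoffSum (pathShiftOn R L (pathShift_mapsTo R L)) (fun ω' => energyMean ω'.1) n ω =
      ∫ t in (0 : ℝ)..n, pathEnergyTot ω.1 t := by
  rw [birkhoffSum]
  refine sum_range_eq_intervalIntegral (fun i => ?_) (intervalIntegrable_pathEnergyTot ω.2) n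
  rw [coe_iterate_pathShiftOn, energyMean_iterate_pathShift ω.2]

omit [DecidableEq d] in
/-- **Birkhoff sums of the mean truncated energy**. -/
theorem birkhoffSum_energyMeanTrunc (ω : ↥(pathSpace (d := d) R L)) (T : Finset (d → ℤ)) (n : ℕ) :
    birkhoffSum (pathShiftOn R L (pathShift_mapsTo R L)) (fun ω' => energyMeanTrunc T ω'.1) n ω =
      ∫ t in (0 : ℝ)..n, pathEnergy T ω.1 t := by
  rw [birkhoffSum]
  refine sum_range_eq_intervalIntegral (fun i => ?_) (intervalIntegrable_pathEnergy ω.2 T) n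
  rw [coe_iterate_pathShiftOn, energyMeanTrunc_iterate_pathShift ω.2]

/-- **Birkhoff sums of the mean resolved dissipation**: `∑_{i<n} F_d(θ^i ω) = ∫₀ⁿ d_K(ω̄(t)) dt`. -/
theorem birkhoffSum_dissMean (ω : ↥(pathSpace (d := d) R L)) (ν : ℝ) (K : ℕ) (n : ℕ) :
    birkhoffSum (pathShiftOn R L (pathShift_mapsTo R L)) (fun ω' => dissMean ν K ω'.1) n ω =
      ∫ t in (0 : ℝ)..n, pathDiss ν K ω.1 t := by
  rw [birkhoffSum]
  refine sum_range_eq_intervalIntegral (fun i => ?_) (intervalIntegrable_pathDiss ω.2 ν K) n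
  rw [coe_iterate_pathShiftOn, dissMean_iterate_pathShift ω.2]

end Summit.AnomalousDissipation.AnomalousDissipation.Theorems.MomentParity
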